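import Mathlib.RepresentationTheory.Character
import Mathlib.RepresentationTheory.Invariants
import Literature.Computability.AlgebraicComplexity.PlethysmStability
import Literature.NumberTheory.DiophantineGeometry.WordHighestWeightSpecht
import Literature.NumberTheory.DiophantineGeometry.SymmetricGroupRepsSignTwist
import HarnessLib

/-!
# Highest-weight vectors of `Symⁿ Symᵐ V`, `Λⁿ Symᵐ V`, `Symⁿ Λᵐ V`, `Λⁿ Λᵐ V` in the word model,
# and the duality `Sym ↔ Λ` under transposition (Fischer–Ikenmeyer 2020, Fact 1)

Source: N. Fischer, C. Ikenmeyer, *The computational complexity of plethysm coefficients*,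
Comput. Complexity 29 (2020) 8 = arXiv:2002.00788 (held), §2, eq. (2) and Fact 1
([Carré 1990; Manivel 1998; Manivel–Michałek 2015]): "If `m` is odd, then
`Λⁿ Λᵐ V = ⊕_λ (S^λ V)^{⊕ a_{λᵀ}(n,m)}` and `Symⁿ Λᵐ V = ⊕_λ (S^λ V)^{⊕ b_{λᵀ}(n,m)}`, whereas in case
that `m` is even: `Λⁿ Λᵐ V = ⊕ (S^λ V)^{⊕ b_{λᵀ}(n,m)}` and `Symⁿ Λᵐ V = ⊕ (S^λ V)^{⊕ a_{λᵀ}(n,m)}`",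
where `a_λ(n,m)`, `b_λ(n,m)` are the multiplicities of `S^λ V` in `Symⁿ Symᵐ V`, `Λⁿ Symᵐ V`. This is
the representation-theoretic input of FI's Lemma 1 (the inner parameter `m` can be fixed) and of
the upper bound of Thm. 4 for `a_λ(n,3)`; it is the first layer of the proof of the barrier fact
`Literature.Barriers.ValiantsHypothesis.FischerIkenmeyer2020_plethysmNPHard`.

**Model.** All four functors are realised inside the tensor power `V^{⊗nm}`, `V = k^N`, in the
tree's word model `wordRep k N (n·m)` (`TensorWordModel.lean`: functions on words
`w : Fin (n·m) → Fin N`), the positions coming in `n` blocks of `m` (`blockIdx`, and the wreath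
product `H = S_n ≀ S_m = blockPerms n m ≤ S_{nm}` of `PlethysmStability.lean`, BIP 2019 §4): for a
linear character `χ : H → {±1}` the space of highest-weight vectors of weight `μ` of the
`χ`-isotypic piece `(V^{⊗nm})^{H,χ} = {x | τ·x = χ(τ) x}` is

  `wreathHW k N χ μ = {x ∈ HW_μ((k^N)^{⊗nm}) | wordPerm τ x = χ(τ) • x for all τ ∈ H}`.

With `s = sign|_H` (`restrSign`) and `σₒ = sign ∘ blockMap` (the sign of the induced permutation
of the blocks, `outerSign`; the sign of the permutations inside the blocks is then `s · σₒᵐ`,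
`restrSign_eq`): `χ = 1` gives `Symⁿ Symᵐ V` (BIP (4.1): "`Sym^d Sym^n V` as the space of
`S_d ≀ S_n`-invariants in `⊗^{dn} V`"), `χ = σₒ` gives `Λⁿ Symᵐ V`, `χ = s σₒᵐ` gives `Symⁿ Λᵐ V`
and `χ = s σₒ^{m+1}` gives `Λⁿ Λᵐ V` (FI §5, proof of Thm. 4: `v_P = ⋀ X_x X_y X_z ∈ Λⁿ Sym³ V`,
`w_P = ⋀ X_x ∧ X_y ∧ X_z ∈ Λⁿ Λ³ V`).

**What is proved** (any field of characteristic zero; no named facts).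

* `blockMap : H →* S_n`, the induced permutation of the blocks, and the decomposition
  `τ = outerBlockPerm (blockMap τ) * innerBlockPerm (innerPerm τ)` (`coe_eq_outer_mul_inner`), with
  the sign bookkeeping `sign (outerBlockPerm π) = (sign π)^m`, `sign (innerBlockPerm e) = ∏ sign (e r)`.
* **The character formula** `|H| · dim wreathHW χ μ = ∑_{τ ∈ H} χ(τ) χ^μ(τ)`
  (`card_mul_finrank_wreathHW`): the `χ`-isotypic vectors are the invariants of the twisted
  restriction `τ ↦ χ(τ) τ` of the tree's `𝔖_{nm}`-representation on `HW_μ` (`hwPermRep`, whose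
  character is the Specht character `χ^μ` by the tree's Schur–Weyl theorem `character_hwPermRep`),
  and `dim V^G = |G|⁻¹ ∑ χ_V` (Mathlib `Representation.card_inv_mul_sum_char_eq_finrank`).
* **Fact 1 in the word model** (`finrank_wreathHW_transpose`):
  `dim wreathHW χ μ = dim wreathHW (s·χ) μᵀ` — since `χ^{μᵀ} = sgn · χ^μ`
  (`spechtCharacter_transpose`) and `sgn² = 1` — for every alphabet size `N ≥ ℓ(μ)` on the left
  and `N' ≥ ℓ(μᵀ)` on the right; in particular the dimensions do not depend on `N ≥ ℓ(μ)`
  (`finrank_wreathHW_eq_of_card_le`). Reading `χ = 1`: `a_μ(n,m) = dim (V^{⊗nm})^{H, s}`-highest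
  weight vectors of weight `μᵀ`, and `s = s σₒ^{m+1}·σₒ^{m+1}` is the `Λⁿ Λᵐ` character for `m` odd
  and the `Symⁿ Λᵐ` character `s σₒᵐ · σₒᵐ` for `m` even — FI's Fact 1, first column; `χ = σₒ`
  gives the second column.

The identification of `a_λ(n,m)` of the barrier file (`plethysmCoeffOfPartition`, G20's
coordinate ring `k[Symᵐ V]`) with `dim wreathHW 1 λ` is the dictionary of `PlethysmStability.lean`
§5 and is carried out in `PlethysmWordModel.lean`.

## References

* [FischerIkenmeyer2020] N. Fischer, C. Ikenmeyer, Comput. Complexity 29 (2020) 8, §2 (eq. (2),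
  Fact 1), §4 (Lemma 1), §5 (Thm. 4, proof).
* [BurgisserIkenmeyerPanovaJAMS2019] P. Bürgisser, C. Ikenmeyer, G. Panova, J. AMS 32 (2019), §4,
  (4.1) (the wreath product `S_d ≀ S_n ≤ S_{dn}` and `Sym^d Sym^n V = (⊗^{dn} V)^{S_d ≀ S_n}`).
* [FultonHarrisGTM129] W. Fulton, J. Harris, *Representation Theory*, GTM 129, §2.2 (2.9)
  (`dim V^G = |G|⁻¹ ∑ χ_V(g)`), Exercise 4.4 (c) (`V_{λ'} = V_λ ⊗ U'`), Thm. 6.3 (2) (Schur–Weyl).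

## Mathlib and tree

Mathlib: `Representation.card_inv_mul_sum_char_eq_finrank`, `Representation.invariants`,
`Representation.character`, `Equiv.Perm.sign_prodCongrLeft`, `Equiv.Perm.sign_prodCongrRight`,
`Equiv.Perm.sign_symm_trans_trans`, `Fintype.ofFinite`. Tree: `blockIdx`, `blockPerms`,
`outerBlockPerm`, `innerBlockPerm` (`PlethysmStability`); `wordRep`, `wordPerm`, `highestWeightSpace`,
`Weight.ofPartition` (`TensorWordModel`, `GLHighestWeight`); `hwPermRep`, `character_hwPermRep`
(`WordHighestWeightSpecht`); `spechtCharacter_transpose`, `sign_cast_mul_self`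
(`SymmetricGroupRepsSignTwist`). Mathlib has no wreath products of symmetric groups and no plethysm.
-/

noncomputable section

open scoped BigOperators

namespace Literature.RepresentationTheory.GeneralLinear

open Literature.NumberTheory.DiophantineGeometry Literature.Computability.AlgebraicComplexity

/-! ### The induced permutation of the blocks and the permutations inside the blocks -/

section BlockMap

variable {n m : ℕ}

/-- The place inside its block to which `τ` sends position `(r, p)`. [folklore] -/
def innerFun (τ : Equiv.Perm (Fin (n * m))) (r : Fin n) (p : Fin m) : Fin m :=
  (finProdFinEquiv.symm (τ (finProdFinEquiv (r, p)))).2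

variable [NeZero m]

/-- The block to which a permutation `τ` of the positions sends block `r` (read off at place `0`
of the block; for `τ` in the wreath product every place gives the same answer,
`blockIdx_apply_of_mem`). BIP §4 ("the permutations … which simultaneously permute the blocks").
[cite: BurgisserIkenmeyerPanovaJAMS2019, §4] -/
def blockMapFun (τ : Equiv.Perm (Fin (n * m))) (r : Fin n) : Fin n :=
  blockIdx n m (τ (finProdFinEquiv (r, (0 : Fin m))))

/-- For `τ ∈ S_n ≀ S_m` the block of `τ (r, p)` is `blockMapFun τ r`, whatever `p`. [folklore] -/
theorem blockIdx_apply_of_mem {τ : Equiv.Perm (Fin (n * m))} (hτ : τ ∈ blockPerms n m)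
    (r : Fin n) (p : Fin m) :
    blockIdx n m (τ (finProdFinEquiv (r, p))) = blockMapFun τ r := by
  rw [blockMapFun, mem_blockPerms.mp hτ]
  simp

/-- **Position formula**: `τ (r, p) = (blockMapFun τ r, innerFun τ r p)` for `τ ∈ S_n ≀ S_m`. [folklore] -/
theorem apply_finProdFinEquiv_of_mem {τ : Equiv.Perm (Fin (n * m))} (hτ : τ ∈ blockPerms n m)
    (r : Fin n) (p : Fin m) :
    τ (finProdFinEquiv (r, p)) = finProdFinEquiv (blockMapFun τ r, innerFun τ r p) := by
  conv_lhs => rw [← finProdFinEquiv_blockIdx (τ (finProdFinEquiv (r, p)))]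
  rw [blockIdx_apply_of_mem hτ]
  rfl

/-- `blockMapFun` is multiplicative on the wreath product. [folklore] -/
theorem blockMapFun_mul {τ τ' : Equiv.Perm (Fin (n * m))} (hτ : τ ∈ blockPerms n m)
    (hτ' : τ' ∈ blockPerms n m) (r : Fin n) :
    blockMapFun (τ * τ') r = blockMapFun τ (blockMapFun τ' r) := by
  have h1 := apply_finProdFinEquiv_of_mem hτ' r (0 : Fin m)
  rw [blockMapFun, Equiv.Perm.mul_apply, h1, blockIdx_apply_of_mem hτ]

/-- `blockMapFun 1 = id`. [folklore] -/
theorem blockMapFun_one (r : Fin n) : blockMapFun (1 : Equiv.Perm (Fin (n * m))) r = r := by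
  simp [blockMapFun]

/-- `blockMapFun τ` is injective for `τ` in the wreath product. [folklore] -/
theorem blockMapFun_injective {τ : Equiv.Perm (Fin (n * m))} (hτ : τ ∈ blockPerms n m) :
    Function.Injective (blockMapFun τ) := by
  intro r r' h
  have := (mem_blockPerms.mp hτ (finProdFinEquiv (r, (0 : Fin m)))
    (finProdFinEquiv (r', (0 : Fin m)))).mp h
  simpa using this

/-- `innerFun τ r` is injective for `τ` in the wreath product. [folklore] -/
theorem innerFun_injective {τ : Equiv.Perm (Fin (n * m))} (hτ : τ ∈ blockPerms n m) (r : Fin n) :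
    Function.Injective (innerFun τ r) := by
  intro p p' h
  have e1 := apply_finProdFinEquiv_of_mem hτ r p
  have e2 := apply_finProdFinEquiv_of_mem hτ r p'
  rw [h] at e1
  have := τ.injective (e1.trans e2.symm)
  simpa using this

/-- **The induced permutation of the blocks**, a group homomorphism `S_n ≀ S_m → S_n`.
BIP §4; FI §2 (the outer symmetric group of the plethysm). [cite: BurgisserIkenmeyerPanovaJAMS2019, §4] -/
def blockMap : ↥(blockPerms n m) →* Equiv.Perm (Fin n) where
  toFun τ := Equiv.ofBijective (blockMapFun (τ : Equiv.Perm (Fin (n * m))))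
    (Finite.injective_iff_bijective.mp (blockMapFun_injective τ.2))
  map_one' := Equiv.ext fun r => by
    simp only [Equiv.ofBijective_apply, OneMemClass.coe_one, Equiv.Perm.coe_one, id_eq]
    exact blockMapFun_one r
  map_mul' τ τ' := Equiv.ext fun r => by
    simp only [Equiv.ofBijective_apply, Subgroup.coe_mul, Equiv.Perm.coe_mul, Function.comp_apply]
    exact blockMapFun_mul τ.2 τ'.2 r

/-- `blockMap τ r = blockMapFun τ r` (unfolding lemma). [folklore] -/
@[simp]
theorem blockMap_apply (τ : ↥(blockPerms n m)) (r : Fin n) :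
    blockMap τ r = blockMapFun (τ : Equiv.Perm (Fin (n * m))) r :=
  rfl

/-- **The permutations inside the blocks** of an element of the wreath product:
`innerPerm τ r` is the bijection `p ↦` place of `τ (r, p)` inside its block. [folklore] -/
def innerPerm (τ : ↥(blockPerms n m)) (r : Fin n) : Equiv.Perm (Fin m) :=
  Equiv.ofBijective (innerFun (τ : Equiv.Perm (Fin (n * m))) r)
    (Finite.injective_iff_bijective.mp (innerFun_injective τ.2 r))

/-- `innerPerm τ r p = innerFun τ r p` (unfolding lemma). [folklore] -/
@[simp]
theorem innerPerm_apply (τ : ↥(blockPerms n m)) (r : Fin n) (p : Fin m) :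
    innerPerm τ r p = innerFun (τ : Equiv.Perm (Fin (n * m))) r p :=
  rfl

/-- **Decomposition of the wreath product**: every `τ ∈ S_n ≀ S_m` is the simultaneous block
permutation `blockMap τ` after the permutations `innerPerm τ` inside the blocks. BIP §4: "It is
generated by the permutations leaving the blocks invariant, and the permutations … which
simultaneously permute the blocks." [cite: BurgisserIkenmeyerPanovaJAMS2019, §4] -/
theorem coe_eq_outer_mul_inner (τ : ↥(blockPerms n m)) :
    (τ : Equiv.Perm (Fin (n * m))) =
      outerBlockPerm n m (blockMap τ) * innerBlockPerm n m (innerPerm τ) := by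
  refine Equiv.ext fun q => ?_
  obtain ⟨⟨r, p⟩, rfl⟩ := finProdFinEquiv.surjective q
  rw [Equiv.Perm.mul_apply, innerBlockPerm_apply, outerBlockPerm_apply,
    apply_finProdFinEquiv_of_mem τ.2]
  rfl

/-- `blockMap` of a simultaneous block permutation `π` is `π`. [folklore] -/
theorem blockMapFun_outerBlockPerm (π : Equiv.Perm (Fin n)) (r : Fin n) :
    blockMapFun (outerBlockPerm n m π) r = π r := by
  simp [blockMapFun, outerBlockPerm_apply]

/-- `blockMap` of permutations inside the blocks is trivial. [folklore] -/
theorem blockMapFun_innerBlockPerm (e : Fin n → Equiv.Perm (Fin m)) (r : Fin n) :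
    blockMapFun (innerBlockPerm n m e) r = r := by
  simp [blockMapFun, innerBlockPerm_apply]

end BlockMap

/-! ### Signs -/

section Signs

variable {n m : ℕ}

/-- The sign of a simultaneous block permutation: `sign (outerBlockPerm π) = (sign π)^m` (a
transposition of two blocks of size `m` is a product of `m` transpositions). [folklore] -/
theorem sign_outerBlockPerm (π : Equiv.Perm (Fin n)) :
    Equiv.Perm.sign (outerBlockPerm n m π) = Equiv.Perm.sign π ^ m := by
  rw [outerBlockPerm, ← Equiv.trans_assoc, Equiv.Perm.sign_symm_trans_trans,
    Equiv.Perm.sign_prodCongrLeft, Finset.prod_const, Finset.card_univ, Fintype.card_fin]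
  rfl

/-- The sign of permutations inside the blocks is the product of their signs. [folklore] -/
theorem sign_innerBlockPerm (e : Fin n → Equiv.Perm (Fin m)) :
    Equiv.Perm.sign (innerBlockPerm n m e) = ∏ r, Equiv.Perm.sign (e r) := by
  rw [innerBlockPerm, ← Equiv.trans_assoc, Equiv.Perm.sign_symm_trans_trans,
    Equiv.Perm.sign_prodCongrRight]

/-- **`s`**: the sign character of `S_{nm}` restricted to the wreath product `S_n ≀ S_m`.
[cite: FischerIkenmeyer2020, §2 (Fact 1)] -/
def restrSign (n m : ℕ) : ↥(blockPerms n m) →* ℤˣ :=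
  Equiv.Perm.sign.comp (blockPerms n m).subtype

/-- `restrSign τ = sign τ` (unfolding lemma). [folklore] -/
@[simp]
theorem restrSign_apply (τ : ↥(blockPerms n m)) :
    restrSign n m τ = Equiv.Perm.sign (τ : Equiv.Perm (Fin (n * m))) :=
  rfl

/-- `s (outerBlockPerm π) = (sign π)^m`. [folklore] -/
theorem restrSign_outer (π : Equiv.Perm (Fin n)) :
    restrSign n m ⟨outerBlockPerm n m π, outerBlockPerm_mem_blockPerms π⟩ = Equiv.Perm.sign π ^ m := by
  rw [restrSign_apply]
  exact sign_outerBlockPerm π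

/-- `s (innerBlockPerm e) = ∏ sign (e r)`. [folklore] -/
theorem restrSign_inner (e : Fin n → Equiv.Perm (Fin m)) :
    restrSign n m ⟨innerBlockPerm n m e, innerBlockPerm_mem_blockPerms e⟩ =
      ∏ r, Equiv.Perm.sign (e r) := by
  rw [restrSign_apply]
  exact sign_innerBlockPerm e

variable [NeZero m]

/-- **`σₒ`**: the sign of the induced permutation of the blocks (the sign character of the
OUTER symmetric group `S_n` pulled back to `S_n ≀ S_m`). Its kernel condition `σₒ = 1` versus
`σₒ`-isotypy distinguishes `Symⁿ(–)` from `Λⁿ(–)`. [cite: FischerIkenmeyer2020, §2 (eq. (2))] -/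
def outerSign : ↥(blockPerms n m) →* ℤˣ :=
  Equiv.Perm.sign.comp blockMap

/-- `outerSign τ = sign (blockMap τ)` (unfolding lemma). [folklore] -/
@[simp]
theorem outerSign_apply (τ : ↥(blockPerms n m)) : outerSign τ = Equiv.Perm.sign (blockMap τ) :=
  rfl

/-- `blockMap` of `outerBlockPerm π` is `π`. [folklore] -/
theorem blockMap_outer (π : Equiv.Perm (Fin n)) :
    blockMap ⟨outerBlockPerm n m π, outerBlockPerm_mem_blockPerms π⟩ = π :=
  Equiv.ext fun r => blockMapFun_outerBlockPerm π r

/-- `blockMap` of `innerBlockPerm e` is `1`. [folklore] -/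
theorem blockMap_inner (e : Fin n → Equiv.Perm (Fin m)) :
    blockMap ⟨innerBlockPerm n m e, innerBlockPerm_mem_blockPerms e⟩ = 1 :=
  Equiv.ext fun r => blockMapFun_innerBlockPerm e r

/-- `σₒ (outerBlockPerm π) = sign π`. [folklore] -/
theorem outerSign_outer (π : Equiv.Perm (Fin n)) :
    outerSign ⟨outerBlockPerm n m π, outerBlockPerm_mem_blockPerms π⟩ = Equiv.Perm.sign π := by
  rw [outerSign_apply, blockMap_outer]

/-- `σₒ (innerBlockPerm e) = 1`. [folklore] -/
theorem outerSign_inner (e : Fin n → Equiv.Perm (Fin m)) :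
    outerSign ⟨innerBlockPerm n m e, innerBlockPerm_mem_blockPerms e⟩ = 1 := by
  rw [outerSign_apply, blockMap_inner, map_one]

/-- **Sign bookkeeping on the wreath product**: `sign τ = (sign (blockMap τ))^m · ∏_r sign (innerPerm τ r)`;
so the product of the signs of the permutations inside the blocks — the character cutting out
`Symⁿ Λᵐ V` — is `s · σₒᵐ`, and `σₒ · ∏ sign (innerPerm τ r)` — cutting out `Λⁿ Λᵐ V` — is
`s · σₒ^{m+1}`. [cite: FischerIkenmeyer2020, §2 (Fact 1)] -/
theorem restrSign_eq (τ : ↥(blockPerms n m)) :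
    restrSign n m τ = outerSign τ ^ m * ∏ r, Equiv.Perm.sign (innerPerm τ r) := by
  rw [restrSign_apply, coe_eq_outer_mul_inner τ, map_mul, sign_outerBlockPerm, sign_innerBlockPerm,
    outerSign_apply]

end Signs

/-! ### Values in `k` of `±1`-valued characters -/

section UnitCast

variable {k : Type*} [Field k]

/-- `u² = 1` in `k` for a unit `u = ±1` of `ℤ`. [folklore] -/
theorem units_cast_mul_self (u : ℤˣ) : ((u : ℤ) : k) * ((u : ℤ) : k) = 1 := by
  rw [← Int.cast_mul, ← Units.val_mul, Int.units_mul_self, Units.val_one, Int.cast_one]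

/-- A unit of `ℤ` is nonzero in a field of characteristic zero… in fact in any field: `±1 ≠ 0`
needs only `1 ≠ 0` (from `u² = 1`). [folklore] -/
theorem units_cast_ne_zero (u : ℤˣ) : ((u : ℤ) : k) ≠ 0 := fun h => by
  have := units_cast_mul_self (k := k) u
  rw [h, zero_mul] at this
  exact zero_ne_one this

end UnitCast

/-! ### Twisting a representation by a `±1`-valued character -/

section CharTwist

variable (k : Type*) [Field k] {G V : Type*} [Group G] [AddCommGroup V] [Module k V]

/-- The twist `ρ ⊗ χ` of a representation by a `±1`-valued linear character: `g ↦ χ(g) ρ(g)`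
(the tree's `signTwist` is the case `χ = sgn`). Fulton–Harris §4.1 (tensoring with a
one-dimensional representation). [folklore] -/
def charTwist (ρ : Representation k G V) (χ : G →* ℤˣ) : Representation k G V where
  toFun g := (((χ g : ℤˣ) : ℤ) : k) • ρ g
  map_one' := by rw [map_one, map_one, Units.val_one, Int.cast_one, one_smul]
  map_mul' g h := by rw [map_mul, map_mul, Units.val_mul, Int.cast_mul, smul_mul_smul_comm]

/-- `(ρ ⊗ χ)(g) = χ(g) ρ(g)` (unfolding lemma). [folklore] -/
@[simp]
theorem charTwist_apply (ρ : Representation k G V) (χ : G →* ℤˣ) (g : G) :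
    charTwist k ρ χ g = (((χ g : ℤˣ) : ℤ) : k) • ρ g :=
  rfl

/-- `χ_{ρ ⊗ χ} = χ · χ_ρ` (Fulton–Harris Prop. 2.1 with a one-dimensional factor). [folklore] -/
theorem character_charTwist [FiniteDimensional k V] (ρ : Representation k G V) (χ : G →* ℤˣ)
    (g : G) : (charTwist k ρ χ).character g = (((χ g : ℤˣ) : ℤ) : k) * ρ.character g := by
  rw [Representation.character, Representation.character, charTwist_apply, map_smul, smul_eq_mul]

/-- The invariants of `ρ ⊗ χ` are the `χ`-isotypic vectors of `ρ`: `ρ(g) v = χ(g) v`. [folklore] -/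
theorem mem_invariants_charTwist_iff (ρ : Representation k G V) (χ : G →* ℤˣ) (v : V) :
    v ∈ (charTwist k ρ χ).invariants ↔ ∀ g : G, ρ g v = (((χ g : ℤˣ) : ℤ) : k) • v := by
  rw [Representation.mem_invariants]
  refine forall_congr' fun g => ?_
  rw [charTwist_apply, LinearMap.smul_apply]
  constructor
  · intro h
    calc ρ g v = ((((χ g : ℤˣ) : ℤ) : k) * (((χ g : ℤˣ) : ℤ) : k)) • ρ g v := by
          rw [units_cast_mul_self, one_smul]
      _ = (((χ g : ℤˣ) : ℤ) : k) • v := by rw [mul_smul, h]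
  · intro h
    rw [h, smul_smul, units_cast_mul_self, one_smul]

end CharTwist

/-! ### The `χ`-isotypic highest-weight vectors of `V^{⊗nm}` under the wreath product -/

section WreathHW

variable (k : Type*) [Field k] (N : ℕ) {n m : ℕ}

/-- **Highest-weight vectors of weight `μ` of the `χ`-isotypic piece of `(k^N)^{⊗nm}` under
`H = S_n ≀ S_m`**: `{x ∈ HW_μ | wordPerm τ x = χ(τ) • x for all τ ∈ H}`. For `χ = 1`, `σₒ`, `s σₒᵐ`,
`s σₒ^{m+1}` these are the highest-weight vectors of weight `μ` of `Symⁿ Symᵐ V`, `Λⁿ Symᵐ V`,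
`Symⁿ Λᵐ V`, `Λⁿ Λᵐ V ⊆ V^{⊗nm}` respectively (BIP (4.1) for the first; FI §5, proof of Thm. 4,
for the wedge models `v_P`, `w_P`). [cite: FischerIkenmeyer2020, §2 (eq. (2)) and §5 (proof of Thm. 4)] -/
def wreathHW (χ : ↥(blockPerms n m) →* ℤˣ) (μ : Weight (Fin N)) :
    Submodule k (Word N (n * m) → k) where
  carrier := {x | x ∈ highestWeightSpace (wordRep k N (n * m)) μ ∧
    ∀ τ : ↥(blockPerms n m),
      wordPerm k (τ : Equiv.Perm (Fin (n * m))) x = (((χ τ : ℤˣ) : ℤ) : k) • x}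
  add_mem' {x y} hx hy := ⟨Submodule.add_mem _ hx.1 hy.1, fun τ => by
    rw [map_add, hx.2 τ, hy.2 τ, smul_add]⟩
  zero_mem' := ⟨Submodule.zero_mem _, fun τ => by rw [map_zero, smul_zero]⟩
  smul_mem' c {x} hx := ⟨Submodule.smul_mem _ c hx.1, fun τ => by
    rw [map_smul, hx.2 τ, smul_comm]⟩

variable {k N}

/-- Membership in `wreathHW` (unfolding lemma). [folklore] -/
theorem mem_wreathHW_iff (χ : ↥(blockPerms n m) →* ℤˣ) (μ : Weight (Fin N))
    (x : Word N (n * m) → k) :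
    x ∈ wreathHW k N χ μ ↔ x ∈ highestWeightSpace (wordRep k N (n * m)) μ ∧
      ∀ τ : ↥(blockPerms n m),
        wordPerm k (τ : Equiv.Perm (Fin (n * m))) x = (((χ τ : ℤˣ) : ℤ) : k) • x :=
  Iff.rfl

/-- `wreathHW χ μ ≤ HW_μ`. [folklore] -/
theorem wreathHW_le_highestWeightSpace (χ : ↥(blockPerms n m) →* ℤˣ) (μ : Weight (Fin N)) :
    wreathHW k N χ μ ≤ highestWeightSpace (wordRep k N (n * m)) μ :=
  fun _ hx => hx.1

/-- Pointwise form of the isotypy: `x (w ∘ τ) = χ(τ) x w`. [folklore] -/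
theorem apply_comp_of_mem_wreathHW {χ : ↥(blockPerms n m) →* ℤˣ} {μ : Weight (Fin N)}
    {x : Word N (n * m) → k} (hx : x ∈ wreathHW k N χ μ) (τ : ↥(blockPerms n m))
    (w : Word N (n * m)) :
    x (w ∘ ⇑(τ : Equiv.Perm (Fin (n * m)))) = (((χ τ : ℤˣ) : ℤ) : k) * x w := by
  have := congrFun (hx.2 τ) w
  rwa [wordPerm_apply, Pi.smul_apply, smul_eq_mul] at this

variable (k N)

/-- The restriction to `H = S_n ≀ S_m` of the tree's representation `hwPermRep` of `S_{nm}` on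
`HW_μ((k^N)^{⊗nm})`, twisted by `χ`; its invariants are the `χ`-isotypic highest-weight vectors.
[cite: FischerIkenmeyer2020, §2 (eq. (2))] -/
def twistedRes (χ : ↥(blockPerms n m) →* ℤˣ) (μ : Weight (Fin N)) :
    Representation k ↥(blockPerms n m) ↥(highestWeightSpace (wordRep k N (n * m)) μ) :=
  charTwist k ((hwPermRep k (D := n * m) μ).comp (blockPerms n m).subtype) χ

/-- The character of `twistedRes χ μ` at `τ` is `χ(τ)` times the character of `S_{nm}` on `HW_μ`
at `τ`. [folklore] -/
theorem character_twistedRes (χ : ↥(blockPerms n m) →* ℤˣ) (μ : Weight (Fin N))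
    (τ : ↥(blockPerms n m)) :
    (twistedRes k N χ μ).character τ =
      (((χ τ : ℤˣ) : ℤ) : k) * (hwPermRep k (D := n * m) μ).character (τ : Equiv.Perm (Fin (n * m))) := by
  rw [twistedRes, character_charTwist]
  rfl

variable {k N}

/-- `x ∈ wreathHW χ μ` iff `x`, as an element of `HW_μ`, is invariant under `twistedRes χ μ`. [folklore] -/
theorem mem_wreathHW_iff_mem_invariants (χ : ↥(blockPerms n m) →* ℤˣ) (μ : Weight (Fin N))
    {x : Word N (n * m) → k} (hx : x ∈ highestWeightSpace (wordRep k N (n * m)) μ) :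
    x ∈ wreathHW k N χ μ ↔
      (⟨x, hx⟩ : ↥(highestWeightSpace (wordRep k N (n * m)) μ)) ∈ (twistedRes k N χ μ).invariants := by
  rw [twistedRes, mem_invariants_charTwist_iff, mem_wreathHW_iff, and_iff_right hx]
  refine forall_congr' fun τ => ?_
  rw [Subtype.ext_iff]
  rfl

variable (k N)

/-- **`wreathHW χ μ ≃ (twistedRes χ μ)`-invariants** (linear). [folklore] -/
def wreathHWEquivInvariants (χ : ↥(blockPerms n m) →* ℤˣ) (μ : Weight (Fin N)) :
    ↥(wreathHW k N χ μ) ≃ₗ[k] ↥(twistedRes k N χ μ).invariants where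
  toFun x := ⟨⟨x.1, x.2.1⟩, (mem_wreathHW_iff_mem_invariants χ μ x.2.1).mp x.2⟩
  invFun v := ⟨(v.1 : Word N (n * m) → k), (mem_wreathHW_iff_mem_invariants χ μ v.1.2).mpr v.2⟩
  map_add' _ _ := rfl
  map_smul' _ _ := rfl
  left_inv _ := rfl
  right_inv _ := rfl

/-- The wreath product as a finite type (for the character sums). [folklore] -/
instance instFintypeBlockPerms : Fintype ↥(blockPerms n m) :=
  Fintype.ofFinite _

/-- **The character formula for the `χ`-isotypic highest-weight vectors**:
`|S_n ≀ S_m| · dim wreathHW χ μ = ∑_{τ ∈ S_n ≀ S_m} χ(τ) χ^μ(τ)` for a partition `μ ⊢ nm` with at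
most `N` parts, in characteristic zero — the multiplicity of `S^μ V` in the `χ`-isotypic piece of
`V^{⊗nm}` (e.g. `a_μ(n,m)` for `χ = 1`) is `⟨χ, Res_H χ^μ⟩_H`. `dim V^H = |H|⁻¹ ∑ χ_V`
(Fulton–Harris (2.9)) for the twisted restriction of `HW_μ`, whose `S_{nm}`-character is the
Specht character (tree's Schur–Weyl theorem `character_hwPermRep`, Fulton–Harris Thm. 6.3 (2)).
[cite: FultonHarrisGTM129, §2.2 (2.9) and Thm. 6.3 (2)] -/
theorem card_mul_finrank_wreathHW [CharZero k] (χ : ↥(blockPerms n m) →* ℤˣ)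
    (μ : Nat.Partition (n * m)) (hμ : μ.parts.card ≤ N) :
    (Nat.card ↥(blockPerms n m) : k) *
        (Module.finrank k ↥(wreathHW k N χ (Weight.ofPartition N μ)) : k) =
      ∑ τ : ↥(blockPerms n m),
        (((χ τ : ℤˣ) : ℤ) : k) * spechtCharacter k μ (τ : Equiv.Perm (Fin (n * m))) := by
  have hcard : (Nat.card ↥(blockPerms n m) : k) ≠ 0 :=
    Nat.cast_ne_zero.mpr (Nat.card_pos (α := ↥(blockPerms n m))).ne'
  haveI : Invertible (Nat.card ↥(blockPerms n m) : k) := invertibleOfNonzero hcard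
  have h := Representation.card_inv_mul_sum_char_eq_finrank (twistedRes k N χ (Weight.ofPartition N μ))
  rw [← (wreathHWEquivInvariants k N χ (Weight.ofPartition N μ)).finrank_eq] at h
  rw [← h, ← mul_assoc, mul_inv_cancel₀ hcard, one_mul]
  refine Finset.sum_congr rfl fun τ _ => ?_
  rw [character_twistedRes, character_hwPermRep k μ hμ]

/-- **Fischer–Ikenmeyer's Fact 1 in the word model: `dim wreathHW χ μ = dim wreathHW (s·χ) μᵀ`.**
Twisting the character by the restricted sign transposes the partition: both sides are
`|H|⁻¹ ∑_τ χ(τ) χ^μ(τ)`, because `χ^{μᵀ} = sgn · χ^μ` (`spechtCharacter_transpose`, Fulton–Harris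
Ex. 4.4 (c)) and `sgn² = 1`. The alphabet sizes `N ≥ ℓ(μ)`, `N' ≥ ℓ(μᵀ)` are arbitrary. With
`χ = 1` this is `a_λ(n,m)` = multiplicity of `λᵀ` in `Λⁿ Λᵐ V` (`m` odd) or in `Symⁿ Λᵐ V`
(`m` even), and with `χ = σₒ` it is the corresponding statement for `b_λ(n,m)` — FI Fact 1.
[cite: FischerIkenmeyer2020, §2 (Fact 1)] -/
theorem finrank_wreathHW_transpose [CharZero k] {N N' : ℕ} (χ : ↥(blockPerms n m) →* ℤˣ)
    (μ : Nat.Partition (n * m)) (hμ : μ.parts.card ≤ N) (hμ' : μ.transpose.parts.card ≤ N') :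
    Module.finrank k ↥(wreathHW k N χ (Weight.ofPartition N μ)) =
      Module.finrank k ↥(wreathHW k N' (restrSign n m * χ) (Weight.ofPartition N' μ.transpose)) := by
  have hcard : (Nat.card ↥(blockPerms n m) : k) ≠ 0 :=
    Nat.cast_ne_zero.mpr (Nat.card_pos (α := ↥(blockPerms n m))).ne'
  have h1 := card_mul_finrank_wreathHW k N χ μ hμ
  have h2 := card_mul_finrank_wreathHW k N' (restrSign n m * χ) μ.transpose hμ'
  have h12 : (∑ τ : ↥(blockPerms n m),
        (((χ τ : ℤˣ) : ℤ) : k) * spechtCharacter k μ (τ : Equiv.Perm (Fin (n * m)))) =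
      ∑ τ : ↥(blockPerms n m), ((((restrSign n m * χ) τ : ℤˣ) : ℤ) : k) *
        spechtCharacter k μ.transpose (τ : Equiv.Perm (Fin (n * m))) := by
    refine Finset.sum_congr rfl fun τ _ => ?_
    rw [MonoidHom.mul_apply, Units.val_mul, Int.cast_mul, restrSign_apply, spechtCharacter_transpose]
    calc (((χ τ : ℤˣ) : ℤ) : k) * spechtCharacter k μ (τ : Equiv.Perm (Fin (n * m)))
        = (((Equiv.Perm.sign (τ : Equiv.Perm (Fin (n * m))) : ℤ) : k) *
            ((Equiv.Perm.sign (τ : Equiv.Perm (Fin (n * m))) : ℤ) : k)) *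
            ((((χ τ : ℤˣ) : ℤ) : k) * spechtCharacter k μ (τ : Equiv.Perm (Fin (n * m)))) := by
          rw [sign_cast_mul_self, one_mul]
      _ = _ := by ring
  rw [h12, ← h2] at h1
  exact_mod_cast mul_left_cancel₀ hcard h1

/-- **The dimension of `wreathHW χ μ` does not depend on the alphabet size `N ≥ ℓ(μ)`** (the
character formula does not mention `N`). [cite: FischerIkenmeyer2020, §2 (eq. (2))] -/
theorem finrank_wreathHW_eq_of_card_le [CharZero k] {N N' : ℕ} (χ : ↥(blockPerms n m) →* ℤˣ)
    (μ : Nat.Partition (n * m)) (hμ : μ.parts.card ≤ N) (hμ' : μ.parts.card ≤ N') :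
    Module.finrank k ↥(wreathHW k N χ (Weight.ofPartition N μ)) =
      Module.finrank k ↥(wreathHW k N' χ (Weight.ofPartition N' μ)) := by
  have hcard : (Nat.card ↥(blockPerms n m) : k) ≠ 0 :=
    Nat.cast_ne_zero.mpr (Nat.card_pos (α := ↥(blockPerms n m))).ne'
  have h1 := card_mul_finrank_wreathHW k N χ μ hμ
  have h2 := card_mul_finrank_wreathHW k N' χ μ hμ'
  rw [← h2] at h1
  exact_mod_cast mul_left_cancel₀ hcard h1

/-- `wreathHW χ μ ≠ ⊥` iff its dimension is positive (it is finite-dimensional). [folklore] -/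
theorem wreathHW_ne_bot_iff_finrank_pos (χ : ↥(blockPerms n m) →* ℤˣ) (μ : Weight (Fin N)) :
    wreathHW k N χ μ ≠ ⊥ ↔ 0 < Module.finrank k ↥(wreathHW k N χ μ) := by
  rw [pos_iff_ne_zero, Ne, Ne, Submodule.finrank_eq_zero]

/-- **Fact 1, positivity form**: `wreathHW χ μ ≠ ⊥ ↔ wreathHW (s·χ) μᵀ ≠ ⊥` (any alphabets
`N ≥ ℓ(μ)`, `N' ≥ ℓ(μᵀ)`). [cite: FischerIkenmeyer2020, §2 (Fact 1)] -/
theorem wreathHW_ne_bot_iff_transpose [CharZero k] {N N' : ℕ} (χ : ↥(blockPerms n m) →* ℤˣ)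
    (μ : Nat.Partition (n * m)) (hμ : μ.parts.card ≤ N) (hμ' : μ.transpose.parts.card ≤ N') :
    wreathHW k N χ (Weight.ofPartition N μ) ≠ ⊥ ↔
      wreathHW k N' (restrSign n m * χ) (Weight.ofPartition N' μ.transpose) ≠ ⊥ := by
  rw [wreathHW_ne_bot_iff_finrank_pos, wreathHW_ne_bot_iff_finrank_pos,
    finrank_wreathHW_transpose k χ μ hμ hμ']

/-- Positivity does not depend on the alphabet size `N ≥ ℓ(μ)`. [cite: FischerIkenmeyer2020, §2 (eq. (2))] -/
theorem wreathHW_ne_bot_iff_of_card_le [CharZero k] {N N' : ℕ} (χ : ↥(blockPerms n m) →* ℤˣ)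
    (μ : Nat.Partition (n * m)) (hμ : μ.parts.card ≤ N) (hμ' : μ.parts.card ≤ N') :
    wreathHW k N χ (Weight.ofPartition N μ) ≠ ⊥ ↔ wreathHW k N' χ (Weight.ofPartition N' μ) ≠ ⊥ := by
  rw [wreathHW_ne_bot_iff_finrank_pos, wreathHW_ne_bot_iff_finrank_pos,
    finrank_wreathHW_eq_of_card_le k χ μ hμ hμ']

/-- The twist `s · (s · χ) = χ` (so `finrank_wreathHW_transpose` can be read both ways). [folklore] -/
theorem restrSign_mul_restrSign_mul (χ : ↥(blockPerms n m) →* ℤˣ) :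
    restrSign n m * (restrSign n m * χ) = χ := by
  ext τ
  rw [MonoidHom.mul_apply, MonoidHom.mul_apply, ← mul_assoc, restrSign_apply, Int.units_mul_self,
    one_mul]

end WreathHW

end Literature.RepresentationTheory.GeneralLinear
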